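import Mathlib
import HarnessLib
import Summits.Parity.Statement
import Summits.Parity.GeneralizedHardyLittlewood.Theses.ClusterGapCarving
import Literature.NumberTheory.Sieve.SingularSeries
import Literature.NumberTheory.Sieve.SingularSeriesProofs
import Literature.NumberTheory.Sieve.SingularSeriesPairProofs
import Summits.Parity.GeneralizedHardyLittlewood.Theorems.EngineToPairs.Negative.EngineToPairsShiftBoundary

/-!
# Glue `TwinLowerFromPairSync` (support item stmt-Parity-26754, route-Parity-ClusterGapCarving)

`FarSomePair → PairSync → ∃ c > 0, ∃ N₀, ∀ N ≥ N₀, c·N ≤ Σ_{n ≤ N} Λ(n)Λ(n+2)`.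

Proof (decomp-parity lens-6 g2 node G3 «ClusterGapCarving», kernel file HOME/decomp-parity-lens-6/
ClusterGapCarving.lean, `twinChebyshevLower_of_pair_sync`; re-targeted here at the gate-written route decls; the singular-series comparison is imported from
`Theorems/EngineToPairs/Negative/EngineToPairsShiftBoundary.lean`):
take the `δ/(2𝔖(2))`-exact even pair `h` of `FarSomePair`, synchronise it with the twins at `δ/2` by
`PairSync`, and use the uniform lower bound `1 ≤ 𝔖({0,2}) ≤ 𝔖({0,h})` (factorwise comparison of the
singular series at even shifts):
`|T − N𝔖₂|·𝔖(h) ≤ |T𝔖(h) − X𝔖₂| + 𝔖₂|X − N𝔖(h)| ≤ δN`.  With `δ = 1/2` and `𝔖₂ ≥ 1` this gives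
`T ≥ N/2` eventually, so `c = 1/2` works.
-/

namespace Summit.Parity.GeneralizedHardyLittlewood.Theorems.ClusterGapCarvingGlue

open Finset Filter Literature.NumberTheory.Sieve
open scoped ArithmeticFunction.vonMangoldt Topology

/-! ### Twin Hardy–Littlewood asymptotic from existence + universality -/

/-- `FarSomePair → PairSync → ∀ δ > 0, |Σ_{n≤N} Λ(n)Λ(n+2) − 𝔖(2)·N| ≤ δN` eventually:
take the exact pair `h = h(δ/(2𝔖(2)))`, synchronise it with the twins at `δ/2`, and use
`𝔖(h) ≥ 1`:  `|T − N𝔖₂|·𝔖(h) ≤ |T𝔖(h) − X𝔖₂| + 𝔖₂|X − N𝔖(h)| ≤ δN`. -/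
theorem twinHL_of_pair_sync (hF : Theses.ClusterGapCarving.FarSomePair)
    (hS : Theses.ClusterGapCarving.PairSync) :
    ∀ δ : ℝ, 0 < δ → ∃ N₁ : ℕ, ∀ N : ℕ, N₁ ≤ N →
      |(∑ n ∈ Finset.Icc 1 N, Λ n * Λ (n + 2)) - (N : ℝ) * singularSeries ({0, 2} : Finset ℤ)| ≤
        δ * N := by
  intro δ hδ
  have hS2 : 1 ≤ singularSeries ({0, 2} : Finset ℤ) := by
    simpa using EngineToPairs.Negative.one_le_singularSeries_pair_of_even (h := 2) ⟨1, rfl⟩ two_ne_zero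
  have hε₁ : 0 < δ / (2 * singularSeries ({0, 2} : Finset ℤ)) :=
    div_pos hδ (mul_pos two_pos (by linarith))
  obtain ⟨h, hh0, hev, N₁, A⟩ := hF _ hε₁
  have hSh : 1 ≤ singularSeries ({0, (h : ℤ)} : Finset ℤ) :=
    EngineToPairs.Negative.one_le_singularSeries_pair_of_even hev hh0
  obtain ⟨N₂, B⟩ := hS h hh0 hev (δ / 2) (by positivity)
  refine ⟨max N₁ N₂, fun N hN => ?_⟩
  have A' := A N (le_trans (le_max_left _ _) hN)
  have B' := B N (le_trans (le_max_right _ _) hN)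
  set S2 : ℝ := singularSeries ({0, 2} : Finset ℤ) with hS2def
  set Sh : ℝ := singularSeries ({0, (h : ℤ)} : Finset ℤ) with hShdef
  set X : ℝ := ∑ n ∈ Icc 1 N, Λ n * Λ (n + h) with hX
  set T : ℝ := ∑ n ∈ Icc 1 N, Λ n * Λ (n + 2) with hTdef
  have hS2pos : 0 < S2 := by linarith
  have hShpos : 0 < Sh := by linarith
  have key : |T - (N : ℝ) * S2| * Sh ≤ δ * N := by
    have e : (T - (N : ℝ) * S2) * Sh = (T * Sh - X * S2) + S2 * (X - (N : ℝ) * Sh) := by ring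
    have e2 : S2 * (δ / (2 * S2) * (N : ℝ)) = δ / 2 * (N : ℝ) := by
      field_simp
    calc |T - (N : ℝ) * S2| * Sh = |(T - (N : ℝ) * S2) * Sh| := by rw [abs_mul, abs_of_pos hShpos]
      _ = |(T * Sh - X * S2) + S2 * (X - (N : ℝ) * Sh)| := by rw [e]
      _ ≤ |T * Sh - X * S2| + |S2 * (X - (N : ℝ) * Sh)| := abs_add_le _ _
      _ = |X * S2 - T * Sh| + S2 * |X - (N : ℝ) * Sh| := by
          rw [abs_sub_comm (T * Sh) (X * S2), abs_mul S2 (X - (N : ℝ) * Sh), abs_of_pos hS2pos]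
      _ ≤ δ / 2 * (N : ℝ) + S2 * (δ / (2 * S2) * (N : ℝ)) :=
          add_le_add B' (mul_le_mul_of_nonneg_left A' hS2pos.le)
      _ = δ * N := by rw [e2]; ring
  have hmono : |T - (N : ℝ) * S2| ≤ |T - (N : ℝ) * S2| * Sh :=
    le_mul_of_one_le_right (abs_nonneg _) hSh
  exact le_trans hmono key

/-- Corollary: the twin CHEBYSHEV lower bound `Σ_{n≤N} Λ(n)Λ(n+2) ≥ N/2` eventually. -/
theorem twinLower_of_pair_sync (hF : Theses.ClusterGapCarving.FarSomePair)
    (hS : Theses.ClusterGapCarving.PairSync) :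
    ∃ N₀ : ℕ, ∀ N : ℕ, N₀ ≤ N → (N : ℝ) / 2 ≤ ∑ n ∈ Finset.Icc 1 N, Λ n * Λ (n + 2) := by
  obtain ⟨N₁, h₁⟩ := twinHL_of_pair_sync hF hS (1 / 2) (by norm_num)
  refine ⟨N₁, fun N hN => ?_⟩
  have hS2 : 1 ≤ singularSeries ({0, 2} : Finset ℤ) := by
    simpa using EngineToPairs.Negative.one_le_singularSeries_pair_of_even (h := 2) ⟨1, rfl⟩ two_ne_zero
  have hN0 : (0 : ℝ) ≤ N := Nat.cast_nonneg N
  have h := (abs_le.mp (h₁ N hN)).1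
  nlinarith [mul_le_mul_of_nonneg_left hS2 hN0]

end Summit.Parity.GeneralizedHardyLittlewood.Theorems.ClusterGapCarvingGlue

namespace Summit.Parity.GeneralizedHardyLittlewood.Theses.ClusterGapCarving

open scoped ArithmeticFunction.vonMangoldt

/-- Support item stmt-Parity-26754 (glue of route-Parity-ClusterGapCarving): `FarSomePair ∧ PairSync`
imply the Λ-weighted twin Chebyshev lower bound `c·N ≤ Σ_{n≤N} Λ(n)Λ(n+2)` eventually, with `c = 1/2`. -/
theorem twinLowerFromPairSync_proof : TwinLowerFromPairSync := by
  intro hF hS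
  obtain ⟨N₀, h₀⟩ := Theorems.ClusterGapCarvingGlue.twinLower_of_pair_sync hF hS
  exact ⟨1 / 2, by norm_num, N₀, fun N hN => by have := h₀ N hN; linarith⟩

end Summit.Parity.GeneralizedHardyLittlewood.Theses.ClusterGapCarving
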